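import Mathlib
import HarnessLib
import Summits.HubbardSuperconductivity.HubbardSuperconductivity.Theorems.BalabanIRBirGappedPhaseReductionRSlavedTrotterCore

/-!
# BalabanIR reduction `BirGappedPhaseReductionR` (stmt-14846): slaved pair field — the one-slice SLAVING IDENTITIES (field insertions reproduce the pair operators)

Support file (`--supports stmt-HubbardSuperconductivity-14846`; prover seat 2, session 11), third part
of the slaved pair-field dictionary of the crux card `slaved-pair-field-os-dictionary` (companions:
`…RSlavedTrotterCore` = per-slice Trotter estimate, `…RSlavedTrotter` = product formula, (R),
positivity).  The card's transfer step needs that insertions of the auxiliary field reproduce the pair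
operators ("`E_ν[φ̄ Y(φ)] = B† + O(a)`", the slaving identity; TRIAGE-r1-3 T5 asks for its EQUAL-TIME
form).  With the four-point surrogate `ν₄ = {φ_k = r iᵏ}`, `aκr² = 1`, source exponents
`W_k = conj φ_k • B + φ_k • Bᴴ` and slices `S_k = e^{aκ W_k}`:

* third moments of `ν₄` vanish (`sum_nu4_cube`, `sum_conj_nu4_cube` and the mixed ones), so that
  `Σ_k conj φ_k • W_k² = Σ_k φ_k • W_k² = 0` (`sum_conj_nu4_smul_sourceExponent_sq`,
  `sum_nu4_smul_sourceExponent_sq`), while `Σ_k conj φ_k • W_k = 4r² • Bᴴ`, `Σ_k φ_k • W_k = 4r² • B`;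
* `norm_avg_smul_exp_sub_le` — abstract insertion estimate in a complete normed `ℂ`-algebra: if
  `Σ c_k = 0`, `Σ c_k • Z_k = 4 • V`, `Σ c_k • Z_k² = 0`, `‖Z_k‖ ≤ z`, `‖c_k‖ ≤ ρ` then
  `‖¼Σ_k c_k • exp Z_k - V‖ ≤ ρ z³ eᶻ` (only the third-order Taylor remainder survives);
* `exists_norm_conjField_insertion_sub_le`, `exists_norm_field_insertion_sub_le` — **the one-slice
  slaving identities** `‖¼Σ_k conj φ_k • S_k - Bᴴ‖ ≤ C a` and `‖¼Σ_k φ_k • S_k - B‖ ≤ C a`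
  (`C = κ(‖B‖+‖Bᴴ‖)³ e^{(1+κ)(‖B‖+‖Bᴴ‖)}`, all `0 ≤ a ≤ 1`);
* `avg_normSq_smul_slice` — the contact term: `¼Σ_k (conj φ_k φ_k) • S_k = r² • S̄` (`= (κa)⁻¹ S̄`);
* `exists_norm_equalTime_twoBlock_sub_le` — **equal-time slaving identity for two independently
  slaved operators** `B₁, B₂` (two blocks in one time slice):
  `‖(1/16)Σ_{k,l} (conj φ_k φ_l) • (S¹_k S²_l) - B₁ᴴ B₂‖ ≤ C a`: the equal-time field two-point
  function IS the equal-time pair correlation `B₁ᴴ B₂` up to `O(a)`, with no cross term — the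
  building block of "field LRO ⇒ equal-time pair LRO" in the direction the target needs.

Matrices carry the `L²` operator norm (`open scoped Matrix.Norms.L2Operator`).
-/

noncomputable section

namespace Summit.HubbardSuperconductivity.HubbardSuperconductivity.Theorems

open scoped Matrix.Norms.L2Operator ComplexConjugate
open Matrix Filter Topology NormedSpace
open Literature.MathematicalPhysics.QuantumLattice

variable {n : Type*} [Fintype n] [DecidableEq n]

/-! ### Third moments of `ν₄` -/

/-- `Σ_k (r iᵏ)³ = r³ Σ_k i^{3k} = 0`. [folklore] -/
theorem sum_nu4_cube (r : ℝ) : ∑ k : Fin 4, ((r : ℂ) * Complex.I ^ (k : ℕ)) ^ 3 = 0 := by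
  have h : ∀ k : ℕ, ((r : ℂ) * Complex.I ^ k) ^ 3 = (r : ℂ) ^ 3 * (Complex.I ^ 3) ^ k := fun k => by
    rw [mul_pow, ← pow_mul, ← pow_mul, mul_comm k 3]
  simp only [h, ← Finset.mul_sum]
  simp [Fin.sum_univ_four, pow_succ]

/-- `Σ_k conj(r iᵏ)³ = 0`. [folklore] -/
theorem sum_conj_nu4_cube (r : ℝ) : ∑ k : Fin 4, (conj ((r : ℂ) * Complex.I ^ (k : ℕ))) ^ 3 = 0 := by
  simp only [← map_pow, ← map_sum, sum_nu4_cube, map_zero]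

/-- Mixed third moment `Σ_k conj φ_k · conj φ_k · φ_k = r² Σ_k conj φ_k = 0`. [folklore] -/
theorem sum_conj_conj_nu4 (r : ℝ) :
    ∑ k : Fin 4, conj ((r : ℂ) * Complex.I ^ (k : ℕ)) * (conj ((r : ℂ) * Complex.I ^ (k : ℕ)) *
      ((r : ℂ) * Complex.I ^ (k : ℕ))) = 0 := by
  simp only [conj_nu4_mul_nu4, ← Finset.sum_mul, sum_conj_nu4, zero_mul]

/-- Mixed third moment `Σ_k conj φ_k · φ_k · conj φ_k = 0`. [folklore] -/
theorem sum_conj_nu4_conj (r : ℝ) :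
    ∑ k : Fin 4, conj ((r : ℂ) * Complex.I ^ (k : ℕ)) * (((r : ℂ) * Complex.I ^ (k : ℕ)) *
      conj ((r : ℂ) * Complex.I ^ (k : ℕ))) = 0 := by
  simp only [mul_comm ((r : ℂ) * Complex.I ^ (_ : ℕ)) (conj _), conj_nu4_mul_nu4, ← Finset.sum_mul,
    sum_conj_nu4, zero_mul]

/-- Mixed third moment `Σ_k conj φ_k · φ_k · φ_k = r² Σ_k φ_k = 0`. [folklore] -/
theorem sum_conj_nu4_nu4 (r : ℝ) :
    ∑ k : Fin 4, conj ((r : ℂ) * Complex.I ^ (k : ℕ)) * (((r : ℂ) * Complex.I ^ (k : ℕ)) *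
      ((r : ℂ) * Complex.I ^ (k : ℕ))) = 0 := by
  rw [show ∑ k : Fin 4, conj ((r : ℂ) * Complex.I ^ (k : ℕ)) * (((r : ℂ) * Complex.I ^ (k : ℕ)) *
      ((r : ℂ) * Complex.I ^ (k : ℕ))) = ∑ k : Fin 4, (conj ((r : ℂ) * Complex.I ^ (k : ℕ)) *
        ((r : ℂ) * Complex.I ^ (k : ℕ))) * ((r : ℂ) * Complex.I ^ (k : ℕ))
    from Finset.sum_congr rfl fun k _ => by ring]
  simp only [conj_nu4_mul_nu4]
  rw [← Finset.mul_sum, sum_nu4, mul_zero]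

/-- Mixed third moment `Σ_k φ_k · conj φ_k · conj φ_k = 0`. [folklore] -/
theorem sum_nu4_conj_conj (r : ℝ) :
    ∑ k : Fin 4, ((r : ℂ) * Complex.I ^ (k : ℕ)) * (conj ((r : ℂ) * Complex.I ^ (k : ℕ)) *
      conj ((r : ℂ) * Complex.I ^ (k : ℕ))) = 0 := by
  rw [show ∑ k : Fin 4, ((r : ℂ) * Complex.I ^ (k : ℕ)) * (conj ((r : ℂ) * Complex.I ^ (k : ℕ)) *
      conj ((r : ℂ) * Complex.I ^ (k : ℕ))) = ∑ k : Fin 4, (conj ((r : ℂ) * Complex.I ^ (k : ℕ)) *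
        ((r : ℂ) * Complex.I ^ (k : ℕ))) * conj ((r : ℂ) * Complex.I ^ (k : ℕ))
    from Finset.sum_congr rfl fun k _ => by ring]
  simp only [conj_nu4_mul_nu4, ← Finset.mul_sum, sum_conj_nu4, mul_zero]

/-- Mixed third moment `Σ_k φ_k · conj φ_k · φ_k = 0`. [folklore] -/
theorem sum_nu4_conj_nu4 (r : ℝ) :
    ∑ k : Fin 4, ((r : ℂ) * Complex.I ^ (k : ℕ)) * (conj ((r : ℂ) * Complex.I ^ (k : ℕ)) *
      ((r : ℂ) * Complex.I ^ (k : ℕ))) = 0 := by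
  simp only [conj_nu4_mul_nu4, ← Finset.sum_mul, sum_nu4, zero_mul]

/-- Mixed third moment `Σ_k φ_k · φ_k · conj φ_k = 0`. [folklore] -/
theorem sum_nu4_nu4_conj (r : ℝ) :
    ∑ k : Fin 4, ((r : ℂ) * Complex.I ^ (k : ℕ)) * (((r : ℂ) * Complex.I ^ (k : ℕ)) *
      conj ((r : ℂ) * Complex.I ^ (k : ℕ))) = 0 := by
  simp only [mul_comm ((r : ℂ) * Complex.I ^ (_ : ℕ)) (conj _), conj_nu4_mul_nu4, ← Finset.sum_mul,
    sum_nu4, zero_mul]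

/-! ### First and second matrix moments against one field insertion -/

/-- Expansion of the squared source exponent. [folklore] -/
theorem sourceExponent_sq_expand (c d : ℂ) (B : Matrix n n ℂ) :
    (c • B + d • Bᴴ) ^ 2 =
      (c * c) • (B * B) + (c * d) • (B * Bᴴ) + (d * c) • (Bᴴ * B) + (d * d) • (Bᴴ * Bᴴ) := by
  rw [sq, add_mul, mul_add, mul_add, smul_mul_smul_comm, smul_mul_smul_comm, smul_mul_smul_comm,
    smul_mul_smul_comm]
  abel

omit [Fintype n] [DecidableEq n] in
/-- `Σ_k conj φ_k • W_k = 4r² • Bᴴ`. [folklore] -/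
theorem sum_conj_nu4_smul_sourceExponent (r : ℝ) (B : Matrix n n ℂ) :
    ∑ k : Fin 4, conj ((r : ℂ) * Complex.I ^ (k : ℕ)) •
      (conj ((r : ℂ) * Complex.I ^ (k : ℕ)) • B + ((r : ℂ) * Complex.I ^ (k : ℕ)) • Bᴴ) =
        (4 * (r : ℂ) ^ 2) • Bᴴ := by
  simp only [smul_add, smul_smul, Finset.sum_add_distrib, ← Finset.sum_smul, conj_nu4_mul_nu4,
    Finset.sum_const, Finset.card_univ, Fintype.card_fin, ← pow_two, sum_conj_nu4_sq, zero_smul,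
    zero_add]
  norm_num

omit [Fintype n] [DecidableEq n] in
/-- `Σ_k φ_k • W_k = 4r² • B`. [folklore] -/
theorem sum_nu4_smul_sourceExponent (r : ℝ) (B : Matrix n n ℂ) :
    ∑ k : Fin 4, ((r : ℂ) * Complex.I ^ (k : ℕ)) •
      (conj ((r : ℂ) * Complex.I ^ (k : ℕ)) • B + ((r : ℂ) * Complex.I ^ (k : ℕ)) • Bᴴ) =
        (4 * (r : ℂ) ^ 2) • B := by
  simp only [smul_add, smul_smul, Finset.sum_add_distrib, ← Finset.sum_smul,
    mul_comm ((r : ℂ) * Complex.I ^ (_ : ℕ)) (conj _), conj_nu4_mul_nu4,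
    Finset.sum_const, Finset.card_univ, Fintype.card_fin, ← pow_two, sum_nu4_sq, zero_smul, add_zero]
  norm_num

/-- `Σ_k conj φ_k • W_k² = 0` (third moments of `ν₄` vanish). [folklore] -/
theorem sum_conj_nu4_smul_sourceExponent_sq (r : ℝ) (B : Matrix n n ℂ) :
    ∑ k : Fin 4, conj ((r : ℂ) * Complex.I ^ (k : ℕ)) •
      (conj ((r : ℂ) * Complex.I ^ (k : ℕ)) • B + ((r : ℂ) * Complex.I ^ (k : ℕ)) • Bᴴ) ^ 2 = 0 := by
  simp only [sourceExponent_sq_expand, smul_add, smul_smul, Finset.sum_add_distrib, ← Finset.sum_smul,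
    sum_conj_conj_nu4, sum_conj_nu4_conj, sum_conj_nu4_nu4, zero_smul, add_zero]
  rw [show ∑ k : Fin 4, conj ((r : ℂ) * Complex.I ^ (k : ℕ)) * (conj ((r : ℂ) * Complex.I ^ (k : ℕ)) *
      conj ((r : ℂ) * Complex.I ^ (k : ℕ))) = ∑ k : Fin 4, (conj ((r : ℂ) * Complex.I ^ (k : ℕ))) ^ 3
    from Finset.sum_congr rfl fun k _ => by ring, sum_conj_nu4_cube, zero_smul]

/-- `Σ_k φ_k • W_k² = 0` (third moments of `ν₄` vanish). [folklore] -/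
theorem sum_nu4_smul_sourceExponent_sq (r : ℝ) (B : Matrix n n ℂ) :
    ∑ k : Fin 4, ((r : ℂ) * Complex.I ^ (k : ℕ)) •
      (conj ((r : ℂ) * Complex.I ^ (k : ℕ)) • B + ((r : ℂ) * Complex.I ^ (k : ℕ)) • Bᴴ) ^ 2 = 0 := by
  simp only [sourceExponent_sq_expand, smul_add, smul_smul, Finset.sum_add_distrib, ← Finset.sum_smul,
    sum_nu4_conj_conj, sum_nu4_conj_nu4, sum_nu4_nu4_conj, zero_smul, zero_add]
  rw [show ∑ k : Fin 4, ((r : ℂ) * Complex.I ^ (k : ℕ)) * (((r : ℂ) * Complex.I ^ (k : ℕ)) *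
      ((r : ℂ) * Complex.I ^ (k : ℕ))) = ∑ k : Fin 4, ((r : ℂ) * Complex.I ^ (k : ℕ)) ^ 3
    from Finset.sum_congr rfl fun k _ => by ring, sum_nu4_cube, zero_smul]

/-! ### The abstract insertion estimate -/

/-- **Abstract insertion estimate** (complete normed `ℂ`-algebra with `‖1‖ = 1`). If the insertion
coefficients `c_k` have `Σ c_k = 0`, `Σ c_k • Z_k = 4 • V` and `Σ c_k • Z_k² = 0`, with `‖Z_k‖ ≤ z`,
`‖c_k‖ ≤ ρ`, then `‖¼Σ_k c_k • exp Z_k - V‖ ≤ ρ z³ eᶻ`: writing `exp Z = 1 + Z + Z²/2 + T(Z)` only the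
third-order remainders `T` survive the average. [folklore] -/
theorem norm_avg_smul_exp_sub_le {𝔸 : Type*} [NormedRing 𝔸] [NormedAlgebra ℂ 𝔸] [NormOneClass 𝔸]
    [CompleteSpace 𝔸] (c : Fin 4 → ℂ) (Z : Fin 4 → 𝔸) (V : 𝔸) (hc0 : ∑ k, c k = 0)
    (hc1 : ∑ k, c k • Z k = (4 : ℂ) • V) (hc2 : ∑ k, c k • Z k ^ 2 = 0) {z ρ : ℝ}
    (hz : ∀ k, ‖Z k‖ ≤ z) (hρ : ∀ k, ‖c k‖ ≤ ρ) :
    ‖(1 / 4 : ℂ) • ∑ k, c k • exp (Z k) - V‖ ≤ ρ * (z ^ 3 * Real.exp z) := by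
  have hz0 : 0 ≤ z := (norm_nonneg _).trans (hz 0)
  have hρ0 : 0 ≤ ρ := (norm_nonneg _).trans (hρ 0)
  set T : Fin 4 → 𝔸 := fun k => exp (Z k) - 1 - Z k - (2 : ℂ)⁻¹ • Z k ^ 2 with hT_def
  have hexp : ∀ k, exp (Z k) = T k + 1 + Z k + (2 : ℂ)⁻¹ • Z k ^ 2 := fun k => by
    simp only [hT_def]; abel
  have hsum : ∑ k, c k • exp (Z k) = ∑ k, c k • T k + (4 : ℂ) • V := by
    have e : ∀ k, c k • exp (Z k) =
        c k • T k + c k • (1 : 𝔸) + c k • Z k + (2 : ℂ)⁻¹ • (c k • Z k ^ 2) := fun k => by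
      rw [hexp k, smul_add, smul_add, smul_add, smul_comm (c k) ((2 : ℂ)⁻¹) (Z k ^ 2)]
    simp only [e, Finset.sum_add_distrib, ← Finset.sum_smul, ← Finset.smul_sum, hc0, hc1, hc2,
      zero_smul, smul_zero, add_zero]
  have hkey : (1 / 4 : ℂ) • ∑ k, c k • exp (Z k) - V = (1 / 4 : ℂ) • ∑ k, c k • T k := by
    rw [hsum, smul_add, smul_smul]
    norm_num
  rw [hkey]
  have hT : ∀ k, ‖c k • T k‖ ≤ ρ * (z ^ 3 * Real.exp z) := fun k => by
    rw [norm_smul]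
    refine mul_le_mul (hρ k) ?_ (norm_nonneg _) hρ0
    calc ‖T k‖ ≤ ‖Z k‖ ^ 3 * Real.exp ‖Z k‖ := norm_exp_sub_one_sub_sub_le ℂ (Z k)
      _ ≤ z ^ 3 * Real.exp z := by gcongr <;> exact hz k
  calc ‖(1 / 4 : ℂ) • ∑ k, c k • T k‖ ≤ ‖(1 / 4 : ℂ)‖ * ∑ k, ‖c k • T k‖ := by
        rw [norm_smul]; gcongr; exact norm_sum_le _ _
    _ ≤ ‖(1 / 4 : ℂ)‖ * ∑ _k : Fin 4, ρ * (z ^ 3 * Real.exp z) := by gcongr with k; exact hT k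
    _ = ρ * (z ^ 3 * Real.exp z) := by
        have h4 : ‖(1 / 4 : ℂ)‖ = 1 / 4 := by simp
        rw [Finset.sum_const, Finset.card_univ, Fintype.card_fin, nsmul_eq_mul, h4]
        push_cast
        ring

/-! ### The one-slice slaving identities -/

/-- **One-slice slaving identity, `φ̄`-insertion.** For any `n × n` matrix `B` and `κ ≥ 0` there is
`C = κ(‖B‖+‖Bᴴ‖)³e^{(1+κ)(‖B‖+‖Bᴴ‖)}` with: for all `0 ≤ a ≤ 1`, `r ≥ 0`, `aκr² = 1`,
`‖¼Σ_{k<4} conj φ_k • e^{aκ(conj φ_k B + φ_k Bᴴ)} - Bᴴ‖ ≤ C a` (`φ_k = r iᵏ`): inserting the conjugate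
auxiliary field reproduces `Bᴴ` (the card's `E_ν[φ̄ Y(φ)] = B† + O(a)`). [folklore] -/
theorem exists_norm_conjField_insertion_sub_le [Nonempty n] (B : Matrix n n ℂ) {κ : ℝ} (hκ : 0 ≤ κ) :
    ∃ C : ℝ, 0 ≤ C ∧ ∀ a r : ℝ, 0 ≤ a → a ≤ 1 → 0 ≤ r → a * κ * r ^ 2 = 1 →
      ‖(1 / 4 : ℂ) • ∑ k : Fin 4, conj ((r : ℂ) * Complex.I ^ (k : ℕ)) • gibbsWeight (-(a * κ))
            (conj ((r : ℂ) * Complex.I ^ (k : ℕ)) • B + ((r : ℂ) * Complex.I ^ (k : ℕ)) • Bᴴ) - Bᴴ‖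
        ≤ C * a := by
  obtain ⟨b, hb⟩ : ∃ b : ℝ, ‖B‖ + ‖Bᴴ‖ = b := ⟨_, rfl⟩
  have hb0 : 0 ≤ b := hb ▸ add_nonneg (norm_nonneg _) (norm_nonneg _)
  refine ⟨κ * b ^ 3 * Real.exp ((1 + κ) * b), by positivity, fun a r ha0 ha1 hr hakr => ?_⟩
  obtain ⟨s, hs⟩ : ∃ s : ℝ, a * κ * r = s := ⟨_, rfl⟩
  have hs0 : 0 ≤ s := by rw [← hs]; positivity
  have hs2 : s ^ 2 = a * κ := by
    have e : s ^ 2 = (a * κ) * (a * κ * r ^ 2) := by rw [← hs]; ring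
    rw [e, hakr, mul_one]
  have hs1 : s ≤ 1 + κ := by
    have h1 : s ^ 2 ≤ (1 + κ) ^ 2 := by
      rw [hs2]; nlinarith [mul_le_of_le_one_left hκ ha1, sq_nonneg κ]
    calc s = Real.sqrt (s ^ 2) := (Real.sqrt_sq hs0).symm
      _ ≤ Real.sqrt ((1 + κ) ^ 2) := Real.sqrt_le_sqrt h1
      _ = 1 + κ := Real.sqrt_sq (by positivity)
  have hrs3 : r * s ^ 3 = a * κ := by
    have e : r * s ^ 3 = (a * κ) * (a * κ * r ^ 2) ^ 2 := by rw [← hs]; ring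
    rw [e, hakr, one_pow, mul_one]
  simp only [gibbsWeight, Complex.ofReal_neg, neg_neg]
  -- hypotheses of the abstract estimate
  have hc0 : ∑ k : Fin 4, conj ((r : ℂ) * Complex.I ^ (k : ℕ)) = 0 := sum_conj_nu4 r
  have hc1 : ∑ k : Fin 4, conj ((r : ℂ) * Complex.I ^ (k : ℕ)) • (((a * κ : ℝ) : ℂ) •
      (conj ((r : ℂ) * Complex.I ^ (k : ℕ)) • B + ((r : ℂ) * Complex.I ^ (k : ℕ)) • Bᴴ)) =
        (4 : ℂ) • Bᴴ := by
    simp only [smul_comm _ (((a * κ : ℝ) : ℂ)), ← Finset.smul_sum]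
    rw [sum_conj_nu4_smul_sourceExponent, smul_smul]
    congr 1
    have hakr' : ((a : ℂ) * κ) * (r : ℂ) ^ 2 = 1 := by exact_mod_cast hakr
    push_cast
    linear_combination (4 : ℂ) * hakr'
  have hc2 : ∑ k : Fin 4, conj ((r : ℂ) * Complex.I ^ (k : ℕ)) • (((a * κ : ℝ) : ℂ) •
      (conj ((r : ℂ) * Complex.I ^ (k : ℕ)) • B + ((r : ℂ) * Complex.I ^ (k : ℕ)) • Bᴴ)) ^ 2 = 0 := by
    simp only [smul_pow, smul_comm _ (((a * κ : ℝ) : ℂ) ^ 2), ← Finset.smul_sum]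
    rw [sum_conj_nu4_smul_sourceExponent_sq, smul_zero]
  have hz : ∀ k : Fin 4, ‖((a * κ : ℝ) : ℂ) •
      (conj ((r : ℂ) * Complex.I ^ (k : ℕ)) • B + ((r : ℂ) * Complex.I ^ (k : ℕ)) • Bᴴ)‖ ≤ s * b := by
    intro k
    rw [norm_smul, Complex.norm_real, Real.norm_of_nonneg (by positivity : 0 ≤ a * κ)]
    have hW : ‖conj ((r : ℂ) * Complex.I ^ (k : ℕ)) • B + ((r : ℂ) * Complex.I ^ (k : ℕ)) • Bᴴ‖
        ≤ r * b :=
      calc _ ≤ ‖conj ((r : ℂ) * Complex.I ^ (k : ℕ)) • B‖ + ‖((r : ℂ) * Complex.I ^ (k : ℕ)) • Bᴴ‖ :=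
            norm_add_le _ _
        _ = r * b := by
            rw [norm_smul, norm_smul, Complex.norm_conj, norm_nu4, abs_of_nonneg hr, ← hb]; ring
    calc a * κ * _ ≤ a * κ * (r * b) := by gcongr
      _ = s * b := by rw [← hs]; ring
  have hρ : ∀ k : Fin 4, ‖conj ((r : ℂ) * Complex.I ^ (k : ℕ))‖ ≤ r := fun k => by
    rw [Complex.norm_conj, norm_nu4, abs_of_nonneg hr]
  refine (norm_avg_smul_exp_sub_le _ _ _ hc0 hc1 hc2 hz hρ).trans ?_
  have hsb : s * b ≤ (1 + κ) * b := mul_le_mul_of_nonneg_right hs1 hb0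
  calc r * ((s * b) ^ 3 * Real.exp (s * b)) ≤ r * ((s * b) ^ 3 * Real.exp ((1 + κ) * b)) := by gcongr
    _ = (r * s ^ 3) * b ^ 3 * Real.exp ((1 + κ) * b) := by ring
    _ = κ * b ^ 3 * Real.exp ((1 + κ) * b) * a := by rw [hrs3]; ring

/-- **One-slice slaving identity, `φ`-insertion.** Same constant: for all `0 ≤ a ≤ 1`, `r ≥ 0`,
`aκr² = 1`, `‖¼Σ_{k<4} φ_k • e^{aκ(conj φ_k B + φ_k Bᴴ)} - B‖ ≤ C a`. [folklore] -/
theorem exists_norm_field_insertion_sub_le [Nonempty n] (B : Matrix n n ℂ) {κ : ℝ} (hκ : 0 ≤ κ) :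
    ∃ C : ℝ, 0 ≤ C ∧ ∀ a r : ℝ, 0 ≤ a → a ≤ 1 → 0 ≤ r → a * κ * r ^ 2 = 1 →
      ‖(1 / 4 : ℂ) • ∑ k : Fin 4, ((r : ℂ) * Complex.I ^ (k : ℕ)) • gibbsWeight (-(a * κ))
            (conj ((r : ℂ) * Complex.I ^ (k : ℕ)) • B + ((r : ℂ) * Complex.I ^ (k : ℕ)) • Bᴴ) - B‖
        ≤ C * a := by
  obtain ⟨b, hb⟩ : ∃ b : ℝ, ‖B‖ + ‖Bᴴ‖ = b := ⟨_, rfl⟩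
  have hb0 : 0 ≤ b := hb ▸ add_nonneg (norm_nonneg _) (norm_nonneg _)
  refine ⟨κ * b ^ 3 * Real.exp ((1 + κ) * b), by positivity, fun a r ha0 ha1 hr hakr => ?_⟩
  obtain ⟨s, hs⟩ : ∃ s : ℝ, a * κ * r = s := ⟨_, rfl⟩
  have hs0 : 0 ≤ s := by rw [← hs]; positivity
  have hs2 : s ^ 2 = a * κ := by
    have e : s ^ 2 = (a * κ) * (a * κ * r ^ 2) := by rw [← hs]; ring
    rw [e, hakr, mul_one]
  have hs1 : s ≤ 1 + κ := by
    have h1 : s ^ 2 ≤ (1 + κ) ^ 2 := by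
      rw [hs2]; nlinarith [mul_le_of_le_one_left hκ ha1, sq_nonneg κ]
    calc s = Real.sqrt (s ^ 2) := (Real.sqrt_sq hs0).symm
      _ ≤ Real.sqrt ((1 + κ) ^ 2) := Real.sqrt_le_sqrt h1
      _ = 1 + κ := Real.sqrt_sq (by positivity)
  have hrs3 : r * s ^ 3 = a * κ := by
    have e : r * s ^ 3 = (a * κ) * (a * κ * r ^ 2) ^ 2 := by rw [← hs]; ring
    rw [e, hakr, one_pow, mul_one]
  simp only [gibbsWeight, Complex.ofReal_neg, neg_neg]
  have hc0 : ∑ k : Fin 4, (r : ℂ) * Complex.I ^ (k : ℕ) = 0 := sum_nu4 r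
  have hc1 : ∑ k : Fin 4, ((r : ℂ) * Complex.I ^ (k : ℕ)) • (((a * κ : ℝ) : ℂ) •
      (conj ((r : ℂ) * Complex.I ^ (k : ℕ)) • B + ((r : ℂ) * Complex.I ^ (k : ℕ)) • Bᴴ)) =
        (4 : ℂ) • B := by
    simp only [smul_comm _ (((a * κ : ℝ) : ℂ)), ← Finset.smul_sum]
    rw [sum_nu4_smul_sourceExponent, smul_smul]
    congr 1
    have hakr' : ((a : ℂ) * κ) * (r : ℂ) ^ 2 = 1 := by exact_mod_cast hakr
    push_cast
    linear_combination (4 : ℂ) * hakr'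
  have hc2 : ∑ k : Fin 4, ((r : ℂ) * Complex.I ^ (k : ℕ)) • (((a * κ : ℝ) : ℂ) •
      (conj ((r : ℂ) * Complex.I ^ (k : ℕ)) • B + ((r : ℂ) * Complex.I ^ (k : ℕ)) • Bᴴ)) ^ 2 = 0 := by
    simp only [smul_pow, smul_comm _ (((a * κ : ℝ) : ℂ) ^ 2), ← Finset.smul_sum]
    rw [sum_nu4_smul_sourceExponent_sq, smul_zero]
  have hz : ∀ k : Fin 4, ‖((a * κ : ℝ) : ℂ) •
      (conj ((r : ℂ) * Complex.I ^ (k : ℕ)) • B + ((r : ℂ) * Complex.I ^ (k : ℕ)) • Bᴴ)‖ ≤ s * b := by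
    intro k
    rw [norm_smul, Complex.norm_real, Real.norm_of_nonneg (by positivity : 0 ≤ a * κ)]
    have hW : ‖conj ((r : ℂ) * Complex.I ^ (k : ℕ)) • B + ((r : ℂ) * Complex.I ^ (k : ℕ)) • Bᴴ‖
        ≤ r * b :=
      calc _ ≤ ‖conj ((r : ℂ) * Complex.I ^ (k : ℕ)) • B‖ + ‖((r : ℂ) * Complex.I ^ (k : ℕ)) • Bᴴ‖ :=
            norm_add_le _ _
        _ = r * b := by
            rw [norm_smul, norm_smul, Complex.norm_conj, norm_nu4, abs_of_nonneg hr, ← hb]; ring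
    calc a * κ * _ ≤ a * κ * (r * b) := by gcongr
      _ = s * b := by rw [← hs]; ring
  have hρ : ∀ k : Fin 4, ‖(r : ℂ) * Complex.I ^ (k : ℕ)‖ ≤ r := fun k => by
    rw [norm_nu4, abs_of_nonneg hr]
  refine (norm_avg_smul_exp_sub_le _ _ _ hc0 hc1 hc2 hz hρ).trans ?_
  have hsb : s * b ≤ (1 + κ) * b := mul_le_mul_of_nonneg_right hs1 hb0
  calc r * ((s * b) ^ 3 * Real.exp (s * b)) ≤ r * ((s * b) ^ 3 * Real.exp ((1 + κ) * b)) := by gcongr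
    _ = (r * s ^ 3) * b ^ 3 * Real.exp ((1 + κ) * b) := by ring
    _ = κ * b ^ 3 * Real.exp ((1 + κ) * b) * a := by rw [hrs3]; ring

/-- **The contact term.** `¼Σ_k (conj φ_k φ_k) • S_k = r² • ¼Σ_k S_k`: the same-point second moment
of the field is `r² = (κa)⁻¹` times the averaged slice (which is `1 + O(a)` by
`exists_norm_slavedSlice_sub_gibbsWeight_le` with `H = 0`), i.e. the `δ_{bb'}δ(τ-τ')/κ` contact
term of the card's slaving identity. [folklore] -/
theorem avg_normSq_smul_slice (a κ r : ℝ) (B : Matrix n n ℂ) :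
    (1 / 4 : ℂ) • ∑ k : Fin 4, (conj ((r : ℂ) * Complex.I ^ (k : ℕ)) * ((r : ℂ) * Complex.I ^ (k : ℕ))) •
        gibbsWeight (-(a * κ))
          (conj ((r : ℂ) * Complex.I ^ (k : ℕ)) • B + ((r : ℂ) * Complex.I ^ (k : ℕ)) • Bᴴ) =
      ((r : ℂ) ^ 2) • ((1 / 4 : ℂ) • ∑ k : Fin 4, gibbsWeight (-(a * κ))
          (conj ((r : ℂ) * Complex.I ^ (k : ℕ)) • B + ((r : ℂ) * Complex.I ^ (k : ℕ)) • Bᴴ)) := by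
  simp only [conj_nu4_mul_nu4, ← Finset.smul_sum, smul_comm ((r : ℂ) ^ 2) (1 / 4 : ℂ)]

/-! ### Equal-time slaving identity for two independently slaved operators -/

omit [DecidableEq n] in
/-- The double average factorises: `(1/16)Σ_{k,l} (c_k d_l) • (X_k Y_l) = (¼Σ_k c_k • X_k)(¼Σ_l d_l • Y_l)`.
[folklore] -/
theorem avg_avg_smul_mul (c d : Fin 4 → ℂ) (X Y : Fin 4 → Matrix n n ℂ) :
    (1 / 16 : ℂ) • ∑ k, ∑ l, (c k * d l) • (X k * Y l) =
      ((1 / 4 : ℂ) • ∑ k, c k • X k) * ((1 / 4 : ℂ) • ∑ l, d l • Y l) := by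
  rw [smul_mul_smul_comm, Finset.sum_mul_sum]
  simp only [smul_mul_smul_comm]
  norm_num

/-- **Equal-time slaving identity (two blocks, one slice).** For `B₁, B₂` with INDEPENDENT `ν₄`
fields `φ, ψ` in the same time slice (two distinct blocks), the equal-time field two-point function
`E[conj φ · ψ · S¹(φ) S²(ψ)] = (1/16)Σ_{k,l} (conj φ_k ψ_l) • (S¹_k S²_l)` equals the equal-time
pair correlation operator `B₁ᴴ B₂` up to `O(a)`: there is `C = C(B₁, B₂, κ)` with
`‖(1/16)Σ_{k,l} (conj φ_k φ_l) • (S¹_k S²_l) - B₁ᴴ B₂‖ ≤ C a` for all `0 ≤ a ≤ 1`, `aκr² = 1` — no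
cross term, and in the direction the target needs (field order bounds EQUAL-TIME pair order).
[folklore] -/
theorem exists_norm_equalTime_twoBlock_sub_le [Nonempty n] (B₁ B₂ : Matrix n n ℂ) {κ : ℝ}
    (hκ : 0 ≤ κ) :
    ∃ C : ℝ, ∀ a r : ℝ, 0 ≤ a → a ≤ 1 → 0 ≤ r → a * κ * r ^ 2 = 1 →
      ‖(1 / 16 : ℂ) • ∑ k : Fin 4, ∑ l : Fin 4,
          (conj ((r : ℂ) * Complex.I ^ (k : ℕ)) * ((r : ℂ) * Complex.I ^ (l : ℕ))) •
            (gibbsWeight (-(a * κ))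
                (conj ((r : ℂ) * Complex.I ^ (k : ℕ)) • B₁ + ((r : ℂ) * Complex.I ^ (k : ℕ)) • B₁ᴴ) *
              gibbsWeight (-(a * κ))
                (conj ((r : ℂ) * Complex.I ^ (l : ℕ)) • B₂ + ((r : ℂ) * Complex.I ^ (l : ℕ)) • B₂ᴴ))
        - B₁ᴴ * B₂‖ ≤ C * a := by
  obtain ⟨C₁, hC₁0, hC₁⟩ := exists_norm_conjField_insertion_sub_le B₁ hκ
  obtain ⟨C₂, hC₂0, hC₂⟩ := exists_norm_field_insertion_sub_le B₂ hκ
  refine ⟨C₁ * (‖B₂‖ + C₂) + ‖B₁ᴴ‖ * C₂, fun a r ha0 ha1 hr hakr => ?_⟩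
  rw [avg_avg_smul_mul]
  -- name the two averaged insertions
  obtain ⟨X, hX⟩ : ∃ X : Matrix n n ℂ, (1 / 4 : ℂ) • ∑ k : Fin 4, conj ((r : ℂ) * Complex.I ^ (k : ℕ)) •
      gibbsWeight (-(a * κ))
        (conj ((r : ℂ) * Complex.I ^ (k : ℕ)) • B₁ + ((r : ℂ) * Complex.I ^ (k : ℕ)) • B₁ᴴ) = X :=
    ⟨_, rfl⟩
  obtain ⟨Y, hY⟩ : ∃ Y : Matrix n n ℂ, (1 / 4 : ℂ) • ∑ l : Fin 4, ((r : ℂ) * Complex.I ^ (l : ℕ)) •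
      gibbsWeight (-(a * κ))
        (conj ((r : ℂ) * Complex.I ^ (l : ℕ)) • B₂ + ((r : ℂ) * Complex.I ^ (l : ℕ)) • B₂ᴴ) = Y :=
    ⟨_, rfl⟩
  have h1 : ‖X - B₁ᴴ‖ ≤ C₁ * a := hX ▸ hC₁ a r ha0 ha1 hr hakr
  have h2 : ‖Y - B₂‖ ≤ C₂ * a := hY ▸ hC₂ a r ha0 ha1 hr hakr
  rw [hX, hY]
  have hYn : ‖Y‖ ≤ ‖B₂‖ + C₂ :=
    calc ‖Y‖ = ‖(Y - B₂) + B₂‖ := by rw [sub_add_cancel]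
      _ ≤ ‖Y - B₂‖ + ‖B₂‖ := norm_add_le _ _
      _ ≤ C₂ * a + ‖B₂‖ := by gcongr
      _ ≤ ‖B₂‖ + C₂ := by nlinarith
  have key : X * Y - B₁ᴴ * B₂ = (X - B₁ᴴ) * Y + B₁ᴴ * (Y - B₂) := by noncomm_ring
  rw [key]
  calc ‖(X - B₁ᴴ) * Y + B₁ᴴ * (Y - B₂)‖ ≤ ‖X - B₁ᴴ‖ * ‖Y‖ + ‖B₁ᴴ‖ * ‖Y - B₂‖ :=
        (norm_add_le _ _).trans (add_le_add (norm_mul_le _ _) (norm_mul_le _ _))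
    _ ≤ (C₁ * a) * (‖B₂‖ + C₂) + ‖B₁ᴴ‖ * (C₂ * a) := by gcongr
    _ = (C₁ * (‖B₂‖ + C₂) + ‖B₁ᴴ‖ * C₂) * a := by ring

end Summit.HubbardSuperconductivity.HubbardSuperconductivity.Theorems

end
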